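import Summits.KontsevichZagierPeriods.KontsevichZagierPeriods.Theses.FurushoPentagon
import Summits.KontsevichZagierPeriods.KontsevichZagierPeriods.Theorems.StuffleInKZ.Negative.Core
import Summits.KontsevichZagierPeriods.KontsevichZagierPeriods.Theorems.FurushoPentagonStuffleInKZDefs
import Literature.NumberTheory.Transcendental.KZProductIdeal
import Literature.NumberTheory.Transcendental.KZLogCalculusProofs
import Literature.NumberTheory.Transcendental.SemialgebraicMapsProofs

/-!
# `StuffleInKZ` (stmt-KontsevichZagierPeriods-3931, route `FurushoPentagon`) — line
`cumulative-cube-lattice-paths`: SKELETON and composition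

The crux: for every assignment `Z` pinned to Kontsevich's simplex classes `[Δ_u] = KZ.of (KZ.mzvRep u …)`
on admissible indices and all admissible `s`, `t`, the stuffle defect
`Z s * Z t − Σ_{u ∈ s ∗ t} Z u` (Hoffman's harmonic product `MZV.stuffle`, with multiplicity) lies in
`KZ.relations`.

LINE (idea card `Cruxes/StuffleInKZ/Ideas/cumulative-cube-lattice-paths.md` ≈ `torus-kernel-subdivision`;
Soudères 2010 §1.3, Markarian 2020 Prop. 2). With `a = weight s`, `b = weight t`:
1. CHART (rule 2, one move per index; `stub_chartCalculus` + `stub_cubeChart`): `[Δ_u] ∼ [(0,1)^{|u|}, cubeKernel u]`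
   along `tᵢ = x₀⋯xᵢ` (lower-triangular Jacobian `∏ᵢ∏_{j<i} x_j > 0`, image the open ordered simplex,
   integrability transported along the chart).
2. PRODUCT (tree, `KZ.Equivalent.prod`): `[Δ_s]·[Δ_t] ∼ [(0,1)^{a+b}, cubeKernel s (x) · cubeKernel t (y)]`.
3. KERNEL IDENTITY (pure algebra on the cube; `stub_pathsCombinatorics` + `stub_kernelStuffle`):
   `cubeKernel s xs · cubeKernel t ys = Σ_{p ∈ paths |s| |t|} pathKernel s t p xs ys`, proved by the
   LAST-STEP recursion of the lattice paths and `(1−A)(1−B) + A(1−B) + B(1−A) = 1 − AB`.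
4. FINITE ADDITIVITY (rule 1b, `|s∗t| − 1` moves; glue lemma `of_sub_list_sum_mem_relations`).
5. TRANSPORT (rule 2, one coordinate permutation per path; `stub_termTransport`): the path kernel is the
   cube kernel of the merged index `merge p s t` at block-interleaved coordinates.
6. ENUMERATION (`stub_enumeration`): `MZV.stuffle s t = (paths |s| |t|).map (merge · s t)` as ORDERED lists.
The degenerate instances `s = []` / `t = []` are the unit law (tree: `Negative.stuffleInKZ_iff_ne_nil`).
No Newton–Leibniz move, no unproved fact, every intermediate a positive rational integral on an open cube.

This file: the six STUBS (sorried, registered on the item) and the sorry-free COMPOSITION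
`StuffleInKZ_of : StuffleInKZ`. Objects: `Theorems/FurushoPentagonStuffleInKZDefs.lean`.
-/

noncomputable section

open Set MeasureTheory
open Literature.NumberTheory.Transcendental
open Literature.NumberTheory.Transcendental.KZ
open Literature.NumberTheory.Transcendental.MZV (IsAdmissible stuffle weight isAdmissible_of_mem_stuffle
  sum_of_mem_stuffle)
open Summit.KontsevichZagierPeriods.KontsevichZagierPeriods.Theses.FurushoPentagon (StuffleInKZ)

namespace Summit.KontsevichZagierPeriods.FurushoPentagon.StuffleInKZ

/-! ## Stubs of the line (registered on stmt-KontsevichZagierPeriods-3931) -/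

/-- STUB (calculus of the chart).  For every `w`, the cumulative-product map `Φ = chart w`,
`Φ(x)ᵢ = ∏_{j ≤ i} x_j`, is injective on the open cube `(0,1)ʷ` (inverse `x₀ = t₀`, `xᵢ = tᵢ/t_{i−1}`),
maps it ONTO Kontsevich's open ordered simplex `{1 > t₀ > t₁ > ⋯ > t_{w−1} > 0}`
(`KZ.openOrderedSimplex`), and at every point of the open cube it has a Fréchet derivative whose
determinant is `∏ᵢ ∏_{j<i} x_j` (the Jacobian matrix `∂Φᵢ/∂x_j = [j ≤ i] ∏_{l ≤ i, l ≠ j} x_l` is lower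
triangular with diagonal `∏_{j<i} x_j`; `HasFDerivAt.finset_prod`, `hasFDerivAt_pi`,
`Matrix.det_of_lowerTriangular`). [cite: Souderes2010, §1.3] -/
theorem stub_chartCalculus : ∀ w : ℕ,
    Set.InjOn (chart w) (openCube w) ∧
    chart w '' openCube w = openOrderedSimplex w ∧
    ∀ x ∈ openCube w, ∃ Φ' : (Fin w → ℝ) →L[ℝ] (Fin w → ℝ),
      HasFDerivAt (chart w) Φ' x ∧
        Φ'.det = ∏ i : Fin w, ∏ j ∈ Finset.univ.filter (fun j : Fin w => j < i), x j := by
  sorry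

/-- STUB (the cube chart — the lead's).  Granted the calculus of the chart: for every non-empty
admissible `u`, (1) the cube representation `[(0,1)^{|u|}, cubeKernel u]` EXISTS as a `KZ.IntegralRep`
(the integrand is a quotient of `ℚ`-polynomials with denominators `1 − (partial product) > 0` on the
open cube, `isSemialgebraicFunOn_aeval_div_aeval`; it is absolutely integrable because it is the
pull-back `(mzvIntegrand u ∘ Φ) · |det Φ'|` of Kontsevich's integrable integrand,
`MeasureTheory.integrableOn_image_iff_integrableOn_abs_det_fderiv_smul`); (2) every representation of
that shape is KZ-EQUIVALENT to `KZ.mzvRep u` by ONE `changeOfVariablesRel` move along `Φ`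
(polynomial, hence `ℚ`-semialgebraic map; injective; image the simplex; and
`mzvIntegrand u (Φ x) · ∏ᵢ∏_{j<i} x_j = cubeKernel u (List.ofFn x)` on the cube: the letters `0` of the
word `0^{u₁−1}1⋯0^{u_k−1}1` contribute `1/t_i` which telescope against the Jacobian, leaving
`∏_{m<k} q_m / (1 − q_{m+1})`, `q_m = x₀⋯x_{u₁+⋯+u_m−1}`), followed by integrand congruence on the
domain. [cite: KontsevichZagier2001, §1.2 rule (2)] -/
theorem stub_cubeChart :
    (∀ w : ℕ, Set.InjOn (chart w) (openCube w) ∧ chart w '' openCube w = openOrderedSimplex w ∧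
      ∀ x ∈ openCube w, ∃ Φ' : (Fin w → ℝ) →L[ℝ] (Fin w → ℝ), HasFDerivAt (chart w) Φ' x ∧
        Φ'.det = ∏ i : Fin w, ∏ j ∈ Finset.univ.filter (fun j : Fin w => j < i), x j) →
    ∀ (u : List ℕ) (hu : IsAdmissible u), u ≠ [] →
      (∃ C : IntegralRep (weight u), C.domain = openCube (weight u) ∧
        Set.EqOn C.integrand (fun x => cubeKernel u (List.ofFn x)) C.domain) ∧
      ∀ C : IntegralRep (weight u), C.domain = openCube (weight u) →
        Set.EqOn C.integrand (fun x => cubeKernel u (List.ofFn x)) C.domain →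
        Equivalent (mzvRep u hu (mzvIntegrand_isSemialgebraicFunOn_holds u)
          (mzvIntegrand_integrableOn_holds u hu)) C := by
  sorry

-- STUB `stub_enumeration` (MZV.stuffle s t = (paths |s| |t|).map (merge · s t)) LANDED with the
-- objects of the line: `Theorems/FurushoPentagonStuffleInKZDefs.lean` (imported).

/-- STUB (combinatorics of lattice paths).  (1) `paths k l` enumerates EXACTLY the step lists with
`k` steps in `{X, D}` and `l` steps in `{Y, D}` (induction on the list for `←`, on `(k,l)` for `→`);
(2) without repetition; (3) hence (both sides are duplicate-free with the same members,
`List.perm_ext_iff_of_nodup`) the LAST-STEP decomposition holds up to permutation: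
`paths (k+1) (l+1) ~ (paths k (l+1))·X ++ (paths (k+1) l)·Y ++ (paths k l)·D`. [folklore] -/
theorem stub_pathsCombinatorics :
    (∀ (k l : ℕ) (p : List Step), p ∈ paths k l ↔ cx p = k ∧ cy p = l) ∧
    (∀ k l : ℕ, (paths k l).Nodup) ∧
    (∀ k l : ℕ, (paths (k + 1) (l + 1)).Perm
      ((paths k (l + 1)).map (· ++ [Step.X]) ++
        ((paths (k + 1) l).map (· ++ [Step.Y]) ++ (paths k l).map (· ++ [Step.D])))) := by
  sorry

/-- STUB (the cube kernel identity, Soudères 2010 Prop. 1.5 / Markarian 2020 Prop. 2).  Granted the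
endpoint count of paths and the last-step decomposition: for index lists with positive entries and
coordinate lists of the right lengths with entries in `(0,1)`,
`cubeKernel s xs · cubeKernel t ys = Σ_{p ∈ paths |s| |t|} pathKernel s t p xs ys`.
PROOF ROUTE: it is the instance `A i = (xs.take (s.take i).sum).prod`, `B j = (ys.take (t.take j).sum).prod`
of the identity in `ℚ(A, B)`: for `A, B : ℕ → ℝ` with `A 0 = B 0 = 1` and `A i · B j ≠ 1` for
`(i, j) ≠ (0, 0)` (`i ≤ k`, `j ≤ l`),
`(∏_{m<k} A m/(1 − A(m+1))) · (∏_{m<l} B m/(1 − B(m+1))) = Σ_{p ∈ paths k l} ∏_{m<|p|} N_p m/(1 − N_p(m+1))`,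
`N_p m = A (cx (p.take m)) · B (cy (p.take m))`, by strong induction on `k + l` through the last-step
decomposition (`List.Perm.sum_eq`), the tail formula `T(p ++ [σ]) = T(p) · N_{|p|} / (1 − N_{|p|+1})`
(`Finset.prod_range_succ`, `List.take_append_of_le_length`), and the one-line partial fraction
`f(a)f(b) = f(ab)(1 + g(a) + g(b))`, `f = 1/(1−·)`, `g = (·)/(1−·)`; on the open cube all partial
products with at least one factor lie in `(0,1)`. [cite: Souderes2010, §1.3 Prop. 1.5] -/
theorem stub_kernelStuffle :
    (∀ (k l : ℕ) (p : List Step), p ∈ paths k l → cx p = k ∧ cy p = l) →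
    (∀ k l : ℕ, (paths (k + 1) (l + 1)).Perm
      ((paths k (l + 1)).map (· ++ [Step.X]) ++
        ((paths (k + 1) l).map (· ++ [Step.Y]) ++ (paths k l).map (· ++ [Step.D])))) →
    ∀ s t : List ℕ, (∀ i ∈ s, 1 ≤ i) → (∀ i ∈ t, 1 ≤ i) →
      ∀ xs ys : List ℝ, xs.length = weight s → ys.length = weight t →
        (∀ x ∈ xs, x ∈ Set.Ioo (0 : ℝ) 1) → (∀ y ∈ ys, y ∈ Set.Ioo (0 : ℝ) 1) →
        cubeKernel s xs * cubeKernel t ys =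
          ((paths s.length t.length).map fun p => pathKernel s t p xs ys).sum := by
  sorry

/-- STUB (term transport: one coordinate permutation per path).  For a step list `p` consuming
exactly `|s|` entries of `s` and `|t|` of `t`: the merged index has weight `weight s + weight t`, and
for every cube representation `C = [(0,1)^{|u|}, cubeKernel u]` of `u = merge p s t` there is a
representation `R` on the cube `(0,1)^{a+b}` whose integrand is (on the cube) the path kernel
`pathKernel s t p (x-coordinates) (y-coordinates)` with `[R] − [C] ∈ KZ.relations`.
PROOF ROUTE: `R` := the coordinate permutation of (the `finCongr` cast of) `C` along the block
interleaving (`KZ.IntegralRep.reindex`, `KZ.of_sub_of_reindex_mem_relations`, or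
`KZ.permRel_subset_relations`): `interleave p s t` applied to the index list `List.finRange (a+b)` is a
duplicate-free list of length `a+b` (it is a permutation of `xs ++ ys`: `List.perm_append_comm`,
induction on `p`), hence an `Equiv` (`List.Nodup.getEquivOfForallMemList`); `interleave` commutes with
`List.map`; and `cubeKernel (merge p s t) (interleave p s t xs ys) = pathKernel s t p xs ys` because the
partial product of the interleaved list at the `m`-th cumulative position of the merged index is the
node product `nodeProd s t p xs ys m` (induction on `p`, `List.take_append`, `List.prod_append`).
[cite: KontsevichZagier2001, §1.2 rule (2)] -/
theorem stub_termTransport : ∀ (s t : List ℕ) (p : List Step), cx p = s.length → cy p = t.length →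
    weight (merge p s t) = weight s + weight t ∧
    ∀ C : IntegralRep (weight (merge p s t)), C.domain = openCube (weight (merge p s t)) →
      Set.EqOn C.integrand (fun w => cubeKernel (merge p s t) (List.ofFn w)) C.domain →
      ∃ R : IntegralRep (weight s + weight t), R.domain = openCube (weight s + weight t) ∧
        Set.EqOn R.integrand (fun z => pathKernel s t p
          (List.ofFn fun i => z (Fin.castAdd (weight t) i))
          (List.ofFn fun j => z (Fin.natAdd (weight s) j))) R.domain ∧
        of R - of C ∈ relations := by
  sorry

/-! ## Glue lemmas -/

section Glue

variable {N : ℕ}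

/-- **Finite integrand additivity over a list** (rule 1b, `|l|` moves peeling one summand at a time;
each remainder `f − g₁ − ⋯ − gᵢ` is semialgebraic and integrable as a difference, so every intermediate
is a representation): if the `Rs i`, `i ∈ l`, live on the domain of `R` and `R.integrand = Σᵢ (Rs i).integrand`
there, then `[R] − Σᵢ [Rs i] ∈ KZ.relations`. [cite: KontsevichZagier2001, §1.2 rule (1)] -/
theorem of_sub_list_sum_mem_relations {ι : Type*} (l : List ι) :
    ∀ (R : IntegralRep N) (Rs : ι → IntegralRep N), (∀ i ∈ l, (Rs i).domain = R.domain) →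
      Set.EqOn R.integrand (fun x => (l.map fun i => (Rs i).integrand x).sum) R.domain →
      of R - (l.map fun i => of (Rs i)).sum ∈ relations := by
  induction l with
  | nil =>
    intro R Rs _ h
    simp only [List.map_nil, List.sum_nil, sub_zero]
    exact of_mem_relations_of_eqOn_zero R (fun x hx => by simpa using h hx)
  | cons a l ih =>
    intro R Rs hd h
    have hda : (Rs a).domain = R.domain := hd a (by simp)
    let R' : IntegralRep N :=
      { domain := R.domain
        integrand := fun x => R.integrand x - (Rs a).integrand x
        isSemialgebraic_domain := R.isSemialgebraic_domain
        isSemialgebraicFunOn_integrand :=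
          IsSemialgebraicFunOn.sub_holds R.isSemialgebraicFunOn_integrand
            (hda ▸ (Rs a).isSemialgebraicFunOn_integrand)
        integrableOn := R.integrableOn.sub (hda ▸ (Rs a).integrableOn) }
    have h1 : of R - of (Rs a) - of R' ∈ relations :=
      integrandAddRel_subset_relations ⟨N, R, Rs a, R', hda, rfl, fun x _ => by
        simp only [Pi.add_apply, R']
        ring, rfl⟩
    have h2 : of R' - (l.map fun i => of (Rs i)).sum ∈ relations :=
      ih R' Rs (fun i hi => (hd i (by simp [hi])).trans rfl) (fun x hx => by
        have hx' : x ∈ R.domain := hx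
        have := h hx'
        simp only [List.map_cons, List.sum_cons] at this
        show R.integrand x - (Rs a).integrand x = _
        rw [this]
        ring)
    have : of R - ((a :: l).map fun i => of (Rs i)).sum =
        (of R - of (Rs a) - of R') + (of R' - (l.map fun i => of (Rs i)).sum) := by
      simp only [List.map_cons, List.sum_cons]
      abel
    rw [this]
    exact relations.add_mem h1 h2

/-- `Σ (F i − G i) = Σ F i − Σ G i` over a list. [folklore] -/
theorem list_sum_map_sub {ι : Type*} (l : List ι) (F G : ι → FormalRep) :
    (l.map fun i => F i - G i).sum = (l.map F).sum - (l.map G).sum := by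
  induction l with
  | nil => simp
  | cons a l ih => simp only [List.map_cons, List.sum_cons, ih]; abel

/-- A list sum of relations is a relation. [folklore] -/
theorem list_sum_mem_relations {ι : Type*} (l : List ι) (F : ι → FormalRep)
    (h : ∀ i ∈ l, F i ∈ relations) : (l.map F).sum ∈ relations := by
  induction l with
  | nil => simp [relations.zero_mem]
  | cons a l ih =>
    rw [List.map_cons, List.sum_cons]
    exact relations.add_mem (h a (by simp)) (ih fun i hi => h i (by simp [hi]))

/-- The product domain of two cube representations is the cube. [folklore] -/
theorem prodDomain_eq_openCube {a b : ℕ} (r : IntegralRep a) (r' : IntegralRep b)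
    (hr : r.domain = openCube a) (hr' : r'.domain = openCube b) :
    IntegralRep.prodDomain r r' = openCube (a + b) := by
  ext z
  simp only [IntegralRep.mem_prodDomain, hr, hr', mem_openCube]
  constructor
  · rintro ⟨h1, h2⟩ i
    refine Fin.addCases (fun i => ?_) (fun j => ?_) i
    · exact h1 i
    · exact h2 j
  · intro h
    exact ⟨fun i => h _, fun j => h _⟩

/-- A term of the stuffle of two non-empty admissible indices is non-empty. [folklore] -/
theorem ne_nil_of_mem_stuffle {s t u : List ℕ} (hs : IsAdmissible s) (hs0 : s ≠ [])
    (hu : u ∈ stuffle s t) : u ≠ [] := by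
  intro h
  have hsum := sum_of_mem_stuffle s t hu
  rw [h, List.sum_nil] at hsum
  obtain ⟨c, s', rfl⟩ := List.exists_cons_of_ne_nil hs0
  have hc : 2 ≤ c := hs.2 (List.cons_ne_nil c s')
  simp only [List.sum_cons] at hsum
  omega

end Glue

/-! ## Composition: the stubs imply the crux -/

open Summit.KontsevichZagierPeriods.Theorems.StuffleInKZ.Negative (stuffleInKZ_iff_ne_nil defect simplexOf)

/-- **The crux from the stubs.** [cite: Hoffman1997, Thm 4.2] -/
theorem StuffleInKZ_of : StuffleInKZ := by
  classical
  rw [stuffleInKZ_iff_ne_nil]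
  intro Z hZ s t hs0 ht0 hs ht
  -- notation
  have hs1 : ∀ i ∈ s, 1 ≤ i := hs.1
  have ht1 : ∀ i ∈ t, 1 ≤ i := ht.1
  -- the charts of `s` and `t`
  have hchart := stub_cubeChart stub_chartCalculus
  obtain ⟨⟨Cs, hCsd, hCsi⟩, hCse⟩ := hchart s hs hs0
  obtain ⟨⟨Ct, hCtd, hCti⟩, hCte⟩ := hchart t ht ht0
  have hEs := hCse Cs hCsd hCsi
  have hEt := hCte Ct hCtd hCti
  -- step 2: the product
  have hprod : of ((mzvRep s hs (mzvIntegrand_isSemialgebraicFunOn_holds s)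
      (mzvIntegrand_integrableOn_holds s hs)).prod (mzvRep t ht
      (mzvIntegrand_isSemialgebraicFunOn_holds t) (mzvIntegrand_integrableOn_holds t ht))) -
      of (Cs.prod Ct) ∈ relations := Equivalent.prod hEs hEt
  -- combinatorics
  obtain ⟨hmem, -, hperm⟩ := stub_pathsCombinatorics
  have hcount : ∀ (k l : ℕ) (p : List Step), p ∈ paths k l → cx p = k ∧ cy p = l :=
    fun k l p hp => (hmem k l p).1 hp
  have henum := stub_enumeration s t
  set P := paths s.length t.length with hP
  have hu_mem : ∀ p ∈ P, merge p s t ∈ stuffle s t := fun p hp => by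
    rw [henum]; exact List.mem_map.mpr ⟨p, hp, rfl⟩
  have hu_adm : ∀ p ∈ P, IsAdmissible (merge p s t) := fun p hp =>
    isAdmissible_of_mem_stuffle hs ht (hu_mem p hp)
  have hu_ne : ∀ p ∈ P, merge p s t ≠ [] := fun p hp => ne_nil_of_mem_stuffle hs hs0 (hu_mem p hp)
  -- the cube representations of the terms (step 1 for each term)
  have hC : ∀ p ∈ P, ∃ C : IntegralRep (weight (merge p s t)),
      (C.domain = openCube (weight (merge p s t)) ∧
        Set.EqOn C.integrand (fun x => cubeKernel (merge p s t) (List.ofFn x)) C.domain) ∧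
      of C - Z (merge p s t) ∈ relations := by
    intro p hp
    obtain ⟨⟨C, hCd, hCi⟩, hCe⟩ := hchart (merge p s t) (hu_adm p hp) (hu_ne p hp)
    refine ⟨C, ⟨hCd, hCi⟩, ?_⟩
    rw [hZ _ (hu_adm p hp)]
    simpa using relations.neg_mem (hCe C hCd hCi)
  -- the transported representations `R p` on the big cube (step 5 for each term)
  have hR : ∀ p ∈ P, ∃ R : IntegralRep (weight s + weight t),
      R.domain = openCube (weight s + weight t) ∧
      Set.EqOn R.integrand (fun z => pathKernel s t p
        (List.ofFn fun i => z (Fin.castAdd (weight t) i))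
        (List.ofFn fun j => z (Fin.natAdd (weight s) j))) R.domain ∧
      of R - Z (merge p s t) ∈ relations := by
    intro p hp
    obtain ⟨C, ⟨hCd, hCi⟩, hCZ⟩ := hC p hp
    obtain ⟨-, hT⟩ := stub_termTransport s t p (hcount _ _ p hp).1 (hcount _ _ p hp).2
    obtain ⟨R, hRd, hRi, hRC⟩ := hT C hCd hCi
    refine ⟨R, hRd, hRi, ?_⟩
    have : of R - Z (merge p s t) = (of R - of C) + (of C - Z (merge p s t)) := by abel
    rw [this]
    exact relations.add_mem hRC hCZ
  let R : List Step → IntegralRep (weight s + weight t) := fun p =>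
    if hp : p ∈ P then Classical.choose (hR p hp) else Cs.prod Ct
  have hRspec : ∀ p (hp : p ∈ P), (R p).domain = openCube (weight s + weight t) ∧
      Set.EqOn (R p).integrand (fun z => pathKernel s t p
        (List.ofFn fun i => z (Fin.castAdd (weight t) i))
        (List.ofFn fun j => z (Fin.natAdd (weight s) j))) (R p).domain ∧
      of (R p) - Z (merge p s t) ∈ relations := by
    intro p hp
    simp only [R, dif_pos hp]
    exact Classical.choose_spec (hR p hp)
  -- step 3 + 4: the kernel identity and finite additivity on the big cube
  have hdom : (Cs.prod Ct).domain = openCube (weight s + weight t) := by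
    rw [IntegralRep.prod_domain]
    exact prodDomain_eq_openCube Cs Ct hCsd hCtd
  have hadd : of (Cs.prod Ct) - (P.map fun p => of (R p)).sum ∈ relations := by
    refine of_sub_list_sum_mem_relations P (Cs.prod Ct) R (fun p hp => by
      rw [(hRspec p hp).1, hdom]) (fun z hz => ?_)
    have hz' : z ∈ openCube (weight s + weight t) := hdom ▸ hz
    have hzs : (fun i => z (Fin.castAdd (weight t) i)) ∈ Cs.domain := by
      rw [IntegralRep.prod_domain, IntegralRep.mem_prodDomain] at hz; exact hz.1
    have hzt : (fun j => z (Fin.natAdd (weight s) j)) ∈ Ct.domain := by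
      rw [IntegralRep.prod_domain, IntegralRep.mem_prodDomain] at hz; exact hz.2
    rw [IntegralRep.prod_integrand_eq, IntegralRep.prodFun_apply, hCsi hzs, hCti hzt]
    have hxs : ∀ x ∈ List.ofFn (fun i => z (Fin.castAdd (weight t) i)), x ∈ Set.Ioo (0 : ℝ) 1 := by
      rw [List.forall_mem_ofFn_iff]; intro i; exact hz' _
    have hys : ∀ y ∈ List.ofFn (fun j => z (Fin.natAdd (weight s) j)), y ∈ Set.Ioo (0 : ℝ) 1 := by
      rw [List.forall_mem_ofFn_iff]; intro j; exact hz' _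
    rw [stub_kernelStuffle hcount hperm s t hs1 ht1 _ _ (List.length_ofFn) (List.length_ofFn) hxs hys]
    congr 1
    refine List.map_congr_left fun p hp => ?_
    exact ((hRspec p hp).2.1 (show z ∈ (R p).domain from (hRspec p hp).1 ▸ hz')).symm
  -- step 5 summed: Σ [R p] − Σ Z (merge p s t) ∈ relations
  have hterms : (P.map fun p => of (R p)).sum - (P.map fun p => Z (merge p s t)).sum ∈ relations := by
    rw [← list_sum_map_sub]
    exact list_sum_mem_relations P _ fun p hp => (hRspec p hp).2.2
  -- step 6: enumeration
  have hZsum : ((stuffle s t).map Z).sum = (P.map fun p => Z (merge p s t)).sum := by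
    rw [henum, List.map_map]
    rfl
  -- assembly
  show defect Z s t ∈ relations
  have hmul : Z s * Z t = of ((mzvRep s hs (mzvIntegrand_isSemialgebraicFunOn_holds s)
      (mzvIntegrand_integrableOn_holds s hs)).prod (mzvRep t ht
      (mzvIntegrand_isSemialgebraicFunOn_holds t) (mzvIntegrand_integrableOn_holds t ht))) := by
    rw [hZ s hs, hZ t ht, simplexOf, simplexOf, of_mul_of]
  have key : defect Z s t =
      (of ((mzvRep s hs (mzvIntegrand_isSemialgebraicFunOn_holds s)
        (mzvIntegrand_integrableOn_holds s hs)).prod (mzvRep t ht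
        (mzvIntegrand_isSemialgebraicFunOn_holds t) (mzvIntegrand_integrableOn_holds t ht))) -
        of (Cs.prod Ct)) +
      ((of (Cs.prod Ct) - (P.map fun p => of (R p)).sum) +
        ((P.map fun p => of (R p)).sum - (P.map fun p => Z (merge p s t)).sum)) := by
    rw [defect, hmul, hZsum]
    abel
  rw [key]
  exact relations.add_mem hprod (relations.add_mem hadd hterms)

end Summit.KontsevichZagierPeriods.FurushoPentagon.StuffleInKZ
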